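import Summits.SmoothPoincare4.SmoothPoincare4.Theses.WeakReductionDescent
import Summits.SmoothPoincare4.SmoothPoincare4.Theorems.WeakReductionDescentWeakReductionReducesStubLoopNoDescentFromFiveAux4
import Summits.SmoothPoincare4.SmoothPoincare4.Theorems.WeakReductionDescentWeakReductionReducesStubLoopFromGenusThreeAux2
import Literature.Topology.FourManifolds.CircleSurgery
import Literature.Topology.FourManifolds.SmoothOrientation
import Literature.Topology.FourManifolds.TrisectionFunctorGKVanKampen
import Literature.Topology.FourManifolds.TrisectionFunctorSPC4
import Literature.Topology.FourManifolds.SimplyConnectedEulerCharacteristic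

/-!
# Crux `WeakReductionReduces` (stmt-SmoothPoincare4-17908), line `loop_dichotomy`, stub H_res
# (`stub_loopResidue`) — the Chu–Tillmann / Euler-characteristic PRUNING of the residue (proved glue)

Stub H_res of skeleton v3 (lead seat c1, `Cruxes/WeakReductionReduces/Lines/loop_dichotomy.lean`,
sha 66732100…) is the typed residue of L₅: a smooth homotopy 4-sphere `M` of MINIMAL GK-trisection
genus `g ≥ 5` is not a surgery on a smoothly embedded loop `ℓ` in an oriented closed smooth `X`
carrying a `(g′; k′)`-GK-trisection with `4 ≤ g′ < g`, `Σ k′ = g′ + 2` (i.e. `χ(X) = 0`) and all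
`k′ᵢ + 2 ≤ g′` (outside the Meier–Schirmer–Zupan range).  It is OPEN (SPC4-shielded; worker log
`work/stubs/stub_loopResidue.log.md`).

This file PROVES that H_res follows from its restriction to the loop partners that survive two
elementary obstructions, both theorems of the tree:

* **Chu–Tillmann's rank bound, per sector** (Chu–Tillmann 2019, §1: "the fundamental group of each
  4–dimensional 1–handlebody surjects onto the fundamental group of `M`, so `g_k ≥ rank π₁(M)`"):
  for a `(g; k)`-GK-trisection of `X` and every base point `x`, there is a surjection
  `F_{k_l} ↠ π₁(X, x)` for each `l` — assembled here
  (`exists_surjective_freeGroup_fundamentalGroup_of_isGKTrisection`) from the PROVED inputs of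
  Abrams–Gay–Kirby's fact (a′): `π₁(F) ↠ π₁(X)` (van Kampen for the three sectors,
  `IsGKTrisection.surjective_inclHom_iInter_and_ker_eq`), its factorisation through `π₁(∂X_l)`
  (`inclHom_comp_inclHomOfSubset`) and `π₁(∂X_l) ≅ F_{k_l}`
  (`IsGKTrisection.isFreeOfRank_fundamentalGroup_sectorBoundary`);
* **the partner is not simply connected** (`nontrivial_fundamentalGroup_of_isGKTrisection_of_sum_eq`):
  `Σ k′ = g′ + 2` is `χ(X) = 0` (`relEuler_eq_of_isGKTrisection`, Gay–Kirby Remark 2), while a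
  closed simply connected 4-manifold has `χ ≥ 2` (`two_le_relEuler_of_simplyConnectedSpace`);
  hence (`one_le_of_isGKTrisection_of_sum_eq`) every `k′_l ≥ rank π₁(X) ≥ 1`: the sub-family of
  H_res with some `k′_l = 0` (non-empty in the signature from `g′ = 6` on: `(6; 0,4,4)`,
  `(7; 0,4,5)`, …) is empty.

Registered helper `helper_loopResidue_of_lowRank : H_res′ → H_res` (stub-add on the crux; lands
`--supports stmt-SmoothPoincare4-17908`), where H_res′ is H_res VERBATIM with the three extra
hypotheses `(∀ i, 1 ≤ k′ i)`, `(∀ x, Nontrivial (π₁(X, x)))`,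
`(∀ i x, ∃ φ : FreeGroup (Fin (k′ i)) →* π₁(X, x), Surjective φ)` inserted before the loop.  Pure
logic over PROVED tree theorems; no named fact is used, none is introduced.  What remains of H_res
after this file is H_res′: partners with all `k′_l ≥ max(1, rank π₁(X))` — first of all the
`rank 1` partners (`π₁(X)` cyclic of weight one with `b₁ = 1`, i.e. `π₁(X) ≅ ℤ`: homotopy
`S¹ × S³`'s such as Gluck twists / surgeries on 2-knots with group `ℤ` in `M`), for which no
obstruction is known.

## References

* M. Chu, S. Tillmann, *Reflections on trisection genus*, Rev. Roumaine Math. Pures Appl. 64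
  (2019), no. 4 (arXiv:1809.04801), §1 "Bounds on trisection genus", p. 2 (the displayed
  inequality `g(M) ≥ χ(M) − 2 + 3 rank(π₁(M))` and `g_k ≥ rank π₁(M)`). [ChuTillmann2019]
* A. Abrams, D. Gay, R. Kirby, *Group trisections and smooth 4-manifolds*, Geom. Topol. 22 (2018),
  p. 1540 (the map `𝒢`). [AbramsGayKirby2018]
* D. Gay, R. Kirby, *Trisecting 4-manifolds*, Geom. Topol. 20 (2016), Remark 2. [GayKirby2016]
* R. Gompf, A. Stipsicz, *4-Manifolds and Kirby Calculus*, GSM 20, AMS 1999, §1.2. [GompfStipsicz1999]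
-/

-- the registered namespace `Summit.SmoothPoincare4.SmoothPoincare4.Theorems…` repeats a component
set_option linter.dupNamespace false

noncomputable section

open scoped Manifold ContDiff Topology ContinuousMap
open Set
open Literature.Topology.FourManifolds
open Literature.AlgebraicTopology.FundamentalGroup Literature.AlgebraicTopology.FundamentalGroup.VanKampen

namespace Summit.SmoothPoincare4.SmoothPoincare4.Theorems.WeakReductionReduces.LoopDichotomy

/-! ## Chu–Tillmann per sector: `F_{k_l} ↠ π₁(X, x)` -/

/-- **Chu–Tillmann, §1, per sector, at a base point of the central surface.**  For a
`(g; k)`-GK-trisection `S` of `X` and `x ∈ F = ⋂ S m`, the fundamental group `π₁(X, x)` is a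
quotient of the free group of rank `k l`, for every sector `l`: `π₁(F) ↠ π₁(X)` (van Kampen for
the three sectors) factors through `π₁(∂X_l) ≅ F_{k_l}`.
[cite: ChuTillmann2019, §1 p. 2 (g_k ≥ rank π₁(M))] [cite: AbramsGayKirby2018, p. 1540 (the map 𝒢)] -/
theorem exists_surjective_freeGroup_fundamentalGroup_of_mem_iInter {X : Type} [TopologicalSpace X]
    [T2Space X] [SecondCountableTopology X] [ChartedSpace (EuclideanSpace ℝ (Fin 4)) X]
    {g : ℕ} {k : Fin 3 → ℕ} {S : Fin 3 → Set X} (h : IsGKTrisection X g k S) (l : Fin 3)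
    {x : X} (hx : x ∈ ⋂ m, S m) :
    ∃ φ : FreeGroup (Fin (k l)) →* FundamentalGroup X x, Function.Surjective φ := by
  -- the base point lies in `∂X_l = S l ∩ (S (l+1) ∪ S (l+2))`
  have hxB : x ∈ S l ∩ (S (l + 1) ∪ S (l + 2)) := iInter_subset_sectorBoundary S l hx
  -- `π₁(∂X_l, x) ≅ F_{k l}`
  obtain ⟨e⟩ := h.isFreeOfRank_fundamentalGroup_sectorBoundary l hxB
  -- `π₁(F, x) ↠ π₁(X, x)` factors through `π₁(∂X_l, x)`, so the latter map is onto as well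
  have hF := (h.surjective_inclHom_iInter_and_ker_eq l hx).1
  have hcomp := inclHom_comp_inclHomOfSubset (iInter_subset_sectorBoundary S l) hx hxB
  have hB : Function.Surjective (inclHom (S l ∩ (S (l + 1) ∪ S (l + 2))) x hxB) := by
    have hc : Function.Surjective ⇑((inclHom (S l ∩ (S (l + 1) ∪ S (l + 2))) x hxB).comp
        (inclHomOfSubset (iInter_subset_sectorBoundary S l) x hx hxB)) := by
      rw [hcomp]; exact hF
    rw [MonoidHom.coe_comp] at hc
    exact hc.of_comp
  exact ⟨(inclHom (S l ∩ (S (l + 1) ∪ S (l + 2))) x hxB).comp e.toMonoidHom,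
    hB.comp e.surjective⟩

/-- **Chu–Tillmann, §1, per sector: `rank π₁(X) ≤ k_l`**, as a surjection `F_{k_l} ↠ π₁(X, x)` at
EVERY base point `x` of a GK-trisected `X` (the central surface is non-empty and `X` is path
connected, so base points may be moved). [cite: ChuTillmann2019, §1 p. 2 (g_k ≥ rank π₁(M))] -/
theorem exists_surjective_freeGroup_fundamentalGroup_of_isGKTrisection {X : Type}
    [TopologicalSpace X] [T2Space X] [SecondCountableTopology X]
    [ChartedSpace (EuclideanSpace ℝ (Fin 4)) X] {g : ℕ} {k : Fin 3 → ℕ} {S : Fin 3 → Set X}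
    (h : IsGKTrisection X g k S) (l : Fin 3) (x : X) :
    ∃ φ : FreeGroup (Fin (k l)) →* FundamentalGroup X x, Function.Surjective φ := by
  obtain ⟨x₀, hx₀⟩ := h.nonempty_iInter
  obtain ⟨φ, hφ⟩ := exists_surjective_freeGroup_fundamentalGroup_of_mem_iInter h l hx₀
  haveI : ConnectedSpace X := connectedSpace_of_isGKTrisection h
  haveI := ChartedSpace.locallyPathConnectedSpace (EuclideanSpace ℝ (Fin 4)) X
  haveI : PathConnectedSpace X := pathConnectedSpace_iff_connectedSpace.mpr inferInstance
  exact ⟨(FundamentalGroup.fundamentalGroupMulEquivOfPathConnected x₀ x).toMonoidHom.comp φ,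
    (FundamentalGroup.fundamentalGroupMulEquivOfPathConnected x₀ x).surjective.comp hφ⟩

/-! ## `χ(X) = 0` forbids `π₁(X) = 1` -/

/-- **A GK-trisected `X` of type `(g; k)` with `Σ kᵢ = g + 2` (i.e. `χ(X) = 0`) is not simply
connected**: `π₁(X, x)` is non-trivial at every base point.  Indeed `χ(X) = 2 + g − Σ kᵢ = 0`
(Gay–Kirby Remark 2, `relEuler_eq_of_isGKTrisection`), whereas a closed simply connected
4-manifold has `χ = 2 + b₂ ≥ 2` (`two_le_relEuler_of_simplyConnectedSpace`).
[cite: GayKirby2016, Remark 2] [cite: GompfStipsicz1999, §1.2] -/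
theorem nontrivial_fundamentalGroup_of_isGKTrisection_of_sum_eq {X : Type} [TopologicalSpace X]
    [T2Space X] [SecondCountableTopology X] [ChartedSpace (EuclideanSpace ℝ (Fin 4)) X]
    [IsManifold (𝓡 4) ∞ X] {g : ℕ} {k : Fin 3 → ℕ} {S : Fin 3 → Set X}
    (h : IsGKTrisection X g k S) (hsum : k 0 + k 1 + k 2 = g + 2) (x : X) :
    Nontrivial (FundamentalGroup X x) := by
  by_contra hnt
  rw [not_nontrivial_iff_subsingleton] at hnt
  haveI : CompactSpace X := h.compactSpace
  haveI : ConnectedSpace X := connectedSpace_of_isGKTrisection h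
  haveI : SimplyConnectedSpace X := simplyConnectedSpace_of_subsingleton_fundamentalGroup x
  have h2 := two_le_relEuler_of_simplyConnectedSpace (X := X)
  have hχ := relEuler_eq_of_isGKTrisection h
  rw [hsum] at hχ
  push_cast at hχ
  omega

/-- **Every sector of such a trisection has at least one `1`-handle: `k_l ≥ 1`** (Chu–Tillmann's
`k_l ≥ rank π₁(X)` with `π₁(X) ≠ 1`): a surjection from `F_0 = 1` would make `π₁(X)` trivial.
[cite: ChuTillmann2019, §1 p. 2 (g_k ≥ rank π₁(M))] [cite: GayKirby2016, Remark 2] -/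
theorem one_le_of_isGKTrisection_of_sum_eq {X : Type} [TopologicalSpace X]
    [T2Space X] [SecondCountableTopology X] [ChartedSpace (EuclideanSpace ℝ (Fin 4)) X]
    [IsManifold (𝓡 4) ∞ X] {g : ℕ} {k : Fin 3 → ℕ} {S : Fin 3 → Set X}
    (h : IsGKTrisection X g k S) (hsum : k 0 + k 1 + k 2 = g + 2) (l : Fin 3) : 1 ≤ k l := by
  rcases Nat.eq_zero_or_pos (k l) with h0 | hpos
  · exfalso
    obtain ⟨x₀, hx₀⟩ := h.nonempty_iInter
    obtain ⟨φ, hφ⟩ := exists_surjective_freeGroup_fundamentalGroup_of_mem_iInter h l hx₀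
    haveI : IsEmpty (Fin (k l)) := by rw [h0]; infer_instance
    haveI : Subsingleton (FundamentalGroup X x₀) := hφ.subsingleton
    haveI := nontrivial_fundamentalGroup_of_isGKTrisection_of_sum_eq h hsum x₀
    exact false_of_nontrivial_of_subsingleton (FundamentalGroup X x₀)
  · exact hpos

/-! ## The registered helper: H_res from its pruned form -/

/-- **`helper_loopResidue_of_lowRank` : H_res′ → H_res** (the Chu–Tillmann / Euler-characteristic
pruning of the residue `stub_loopResidue`).  H_res′ is H_res verbatim with three extra hypotheses
on the loop partner `X` — all `k′_l ≥ 1`; `π₁(X, x) ≠ 1` at every base point; a surjection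
`F_{k′_l} ↠ π₁(X, x)` for every `l` and `x` (`rank π₁(X) ≤ min_l k′_l`, so
`3 · rank π₁(X) ≤ Σ k′ = g′ + 2`) — and each of them is PROVED above for every partner admitted
by H_res (`Σ k′ = g′ + 2`).  So the partners of H_res with some `k′_l = 0` never occur, and what is
left is exactly H_res′. [cite: ChuTillmann2019, §1 p. 2 (g(M) ≥ χ(M) − 2 + 3 rank π₁(M))]
[cite: GayKirby2016, Remark 2] -/
theorem helper_loopResidue_of_lowRank : (∀ (M : Type) [TopologicalSpace M] [T2Space M] [SecondCountableTopology M] [ChartedSpace (EuclideanSpace ℝ (Fin 4)) M] [IsManifold (𝓡 4) ∞ M], (M ≃ₕ (Metric.sphere (0 : EuclideanSpace ℝ (Fin 5)) 1)) → ∀ (g : ℕ) (k : Fin 3 → ℕ) (T : Fin 3 → Set M), Literature.Topology.FourManifolds.IsGKTrisection M g k T → 5 ≤ g → (∀ (g'' : ℕ) (k'' : Fin 3 → ℕ) (T'' : Fin 3 → Set M), Literature.Topology.FourManifolds.IsGKTrisection M g'' k'' T'' → g ≤ g'') → ∀ (X : Type) [TopologicalSpace X] [T2Space X] [SecondCountableTopology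 X] [ChartedSpace (EuclideanSpace ℝ (Fin 4)) X] [IsManifold (𝓡 4) ∞ X], Literature.Topology.FourManifolds.IsOrientable (𝓡 4) X → ∀ (g' : ℕ) (k' : Fin 3 → ℕ) (T' : Fin 3 → Set X), 4 ≤ g' → g' < g → Literature.Topology.FourManifolds.IsGKTrisection X g' k' T' → k' 0 + k' 1 + k' 2 = g' + 2 → (∀ i, k' i + 2 ≤ g') → (∀ i, 1 ≤ k' i) → (∀ x : X, Nontrivial (FundamentalGroup X x)) → (∀ (i : Fin 3) (x : X), ∃ φ : FreeGroup (Fin (k' i)) →* FundamentalGroup X x, Function.Surjective φ) → ∀ (ℓ : (Metric.sphere (0 : EuclideanSpace ℝ (Fin 2)) 1) → X), Manifold.IsSmoothEmbedding (𝓡 1) (𝓡 4) ∞ ℓ → ¬ Literature.Topology.FourManifolds.IsCircleSurgery (𝓡 4) (𝓡 4) X M ℓ) → ∀ (M : Type) [TopologicalSpace M] [T2Space M] [SecondCountableTopology M] [ChartedSpace (EuclideanSpace ℝ (Fin 4)) M] [IsManifold (𝓡 4) ∞ M], (M ≃ₕ (Metric.sphere (0 : EuclideanSpace ℝ (Fin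 5)) 1)) → ∀ (g : ℕ) (k : Fin 3 → ℕ) (T : Fin 3 → Set M), Literature.Topology.FourManifolds.IsGKTrisection M g k T → 5 ≤ g → (∀ (g'' : ℕ) (k'' : Fin 3 → ℕ) (T'' : Fin 3 → Set M), Literature.Topology.FourManifolds.IsGKTrisection M g'' k'' T'' → g ≤ g'') → ∀ (X : Type) [TopologicalSpace X] [T2Space X] [SecondCountableTopology X] [ChartedSpace (EuclideanSpace ℝ (Fin 4)) X] [IsManifold (𝓡 4) ∞ X], Literature.Topology.FourManifolds.IsOrientable (𝓡 4) X → ∀ (g' : ℕ) (k' : Fin 3 → ℕ) (T' : Fin 3 → Set X), 4 ≤ g' → g' < g → Literature.Topology.FourManifolds.IsGKTrisection X g' k' T' → k' 0 + k' 1 + k' 2 = g' + 2 → (∀ i, k' i + 2 ≤ g') → ∀ (ℓ : (Metric.sphere (0 : EuclideanSpace ℝ (Fin 2)) 1) → X), Manifold.IsSmoothEmbedding (𝓡 1) (𝓡 4) ∞ ℓ → ¬ Literature.Topology.FourManifolds.IsCircleSurgery (𝓡 4) (𝓡 4) X M ℓ := by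
  intro hR M _ _ _ _ _ e g k T hT hg5 hmin X _ _ _ _ _ hXo g' k' T' h4 hlt hT' hsum hout ℓ hℓ
  exact hR M e g k T hT hg5 hmin X hXo g' k' T' h4 hlt hT' hsum hout
    (fun i => one_le_of_isGKTrisection_of_sum_eq hT' hsum i)
    (fun x => nontrivial_fundamentalGroup_of_isGKTrisection_of_sum_eq hT' hsum x)
    (fun i x => exists_surjective_freeGroup_fundamentalGroup_of_isGKTrisection hT' i x) ℓ hℓ

end Summit.SmoothPoincare4.SmoothPoincare4.Theorems.WeakReductionReduces.LoopDichotomy
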